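/-
Copyright (c) 2026 the pub-hodgecm-mathlib formalisation cell (harness21).  Prover seat hodgecm-mathlib-K2Liu-p10 (g2), Track B «K2-LIT»,
#184♮ = hLiu418 = `stmt-HodgeConjecture-24832`; LEAD F0P6-plan (g13) RULINGS «M-157a» (1) ∕ «M-157j» (1): G5-a sub-organ (α) (the middle cell of the
constant term), file α2a — THE SUM OVER ONE `N_Δ(L⁺)`-ORBIT OF MIDDLE COSETS IS ONE WEIGHTED INTEGRAL, FOR ANY STABILISER COVERING WEIGHT.
THEOREMS ONLY (no `def`, no `instance`, no named-fact hypothesis, no `sorry`).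
-/
import Summits.HodgeConjecture.HodgeConjecture.Theorems.K2LiuSiegelEisensteinCoeffMiddleOrbits
import HarnessLib

/-!
# Crux `HLiu418`, ROAD Φ, (α) file α2a: ONE `N_Δ(L⁺)`-ORBIT OF `P_Δ(L⁺)∖H(L⁺)` AS ONE WEIGHTED INTEGRAL —
# `Σ_{q ∈ O(γ₀)} ∫ β(u)·ψ̄_S(u)·f(γ_q u h) dνN = ∫ β₁(u)·ψ̄_S(u)·f(γ₀ u h) dνN` for ANY `Stab(γ₀)`-covering weight `β₁`

Cell `hodgecm-mathlib`, crux item hLiu418 = `stmt-HodgeConjecture-24832` (helper lane, count-neutral).  K2Liu-p06 (g3)'s ★ Φ2 files prove that the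
orbit sum VANISHES when the stabiliser carries a character-killing element (★ `K2LiuSiegelEisensteinCoeffMiddleOrbits.tsum_orbit_eq_zero`, via ★
`K2LiuSiegelEisensteinCoeffOrbitSum.tsum_section_eq_zero`); for the CONSTANT TERM (`S = 0`, ★ `unipDeltaChar_zero`) nothing dies and one needs the
companion IDENTITY, which ★ `K2LiuSiegelEisensteinCoeffOrbitSum.tsum_section_eq_integral_wt_smul` already provides along a section of
`Stab(γ₀)∖N_Δ(L⁺)`.  This file packages it exactly as ★ `tsum_orbit_eq_zero` packages the vanishing — the orbit `O(γ₀) = {[γ₀ ν]}` is its own section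
(`[γ₀ ν_q] = q`), the stabiliser `Stab(γ₀) = {ν ∈ N_Δ(L⁺) : γ₀ ν γ₀⁻¹ ∈ P_Δ}` enters through its membership law (★ `exists_stabilizer_subgroup`), and the
weight on the right is ARBITRARY:
* **`tsum_orbit_eq_integral_wt_smul`** — `νN` left-invariant, `β` an `N_Δ(L⁺)`-covering weight, `f` a continuous Siegel section, `γ₀ ∈ H(L⁺)`, `S` any
  index, `Γ'` with `u ∈ Γ' ↔ u ∈ N_Δ(L⁺) ∧ γ₀ u γ₀⁻¹ ∈ P_Δ`, `β₁` ANY `Γ'`-covering weight, and the orbit `L¹` bound (a slice of (H)):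
  `Σ'_{q ∈ O(γ₀)} ∫ β(u) • (ψ̄_S(u) f(γ_q u h)) dνN = ∫ β₁(u) • (ψ̄_S(u) f(γ₀ u h)) dνN`;
* `tsum_orbit_eq_integral_wt_smul_zero` — the `S = 0` reading without the character (the middle cell of ★ `constTerm_three_cells`).
Sources: [MoeglinWaldspurger1995, II.1.7]; [KudlaRallis1994, §2 (2.10)–(2.12)]; [GelbartPiatetskishapiroRallis1987, Part A §2]; [Garrett2018, §3.10].
HONEST LABEL.  Helper lemmas, count-neutral; `HC_CM` is proved only modulo the 7 printed citations (2 remaining named inputs: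
hLiu418 = `stmt-HodgeConjecture-24832`, h413 = `stmt-HodgeConjecture-24833`) until rung 0 closes.
-/

set_option autoImplicit false
set_option linter.dupNamespace false -- the mandated namespace repeats `HodgeConjecture.HodgeConjecture`

noncomputable section

open scoped Matrix ENNReal NNReal ComplexConjugate
open NumberField IsDedekindDomain MeasureTheory MeasureTheory.Measure Filter Set Function
open Literature.NumberTheory.Automorphic Literature.NumberTheory.Automorphic.UnitaryGroup Literature.NumberTheory.GaloisRepresentations
open Literature.NumberTheory.GelbartRogawski1991 Literature.NumberTheory.GelbartRogawski1991.GRConstruction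
open Literature.NumberTheory.K2Lit.SiegelDoubled Literature.MeasureTheory.Group
open UnitaryDualPair

namespace Summit.HodgeConjecture.HodgeConjecture.Cruxes.HLiu418.K2LiuSiegelMiddleOrbitUnfold

open K2LiuUnipotentCoveringWeight K2LiuConstantTermBigCellUnfold K2LiuSiegelDoubledUnfold K2LiuSiegelUnipotentFourierDefs K2LiuSiegelUnipotentCharacters
  K2LiuSiegelEisensteinCoeffCells K2LiuSiegelEisensteinCoeffOrbitVanishing K2LiuSiegelEisensteinCoeffOrbitSum K2LiuSiegelBruhatMiddleCellDelta
  K2LiuSiegelEisensteinCoeffMiddleOrbits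

variable {L : Type} [Field L] [NumberField L] [IsCMField L]
variable {N M n : ℕ} {e : Fin N × Fin M ≃ Fin n}
  {dV : Fin N → L} {hdV : ∀ i, IsCMField.complexConj L (dV i) = dV i}
  {dW : Fin M → L} {hdW : ∀ i, IsCMField.complexConj L (dW i) = dW i}
variable [MeasurableSpace (unipDelta L e dV hdV dW hdW)] [BorelSpace (unipDelta L e dV hdV dW hdW)]

/-! ## 1. The orbit sum as one weighted integral -/

/-- **THE SUM OVER ONE ORBIT IS ONE WEIGHTED INTEGRAL, FOR ANY STABILISER WEIGHT.**  `νN` left-invariant on `N_Δ(𝔸)`, `β` an `N_Δ(L⁺)`-covering weight,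
`f` a continuous Siegel section, `γ₀ ∈ H(L⁺)`, `h ∈ H(𝔸)`, `S` an index, `Γ' = Stab(γ₀)` (membership law), `β₁` any `Γ'`-covering weight, and the orbit
absolutely integrable against `β` (a slice of (H)).  Then
`Σ'_{q ∈ O(γ₀)} ∫ β(u) • (ψ̄_S(u) · f(γ_q u h)) dνN(u) = ∫ β₁(u) • (ψ̄_S(u) · f(γ₀ u h)) dνN(u)`
(★ `tsum_section_eq_integral_wt_smul` for the section `q ↦ ν_q`, `[γ₀ ν_q] = q`, of `Stab(γ₀)∖N_Δ(L⁺)`; ★ `apply_out_orbit`).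
[cite: MoeglinWaldspurger1995, II.1.7] [cite: KudlaRallis1994, §2] -/
theorem tsum_orbit_eq_integral_wt_smul (νN : Measure (unipDelta L e dV hdV dW hdW)) [νN.IsMulLeftInvariant]
    {β : unipDelta L e dV hdV dW hdW → ℝ≥0∞} (hβ : IsCoveringWeight (unipDeltaRat L e dV hdV dW hdW) β)
    {χ : HeckeCharacter L} {s : ℂ} {f : HA L e dV hdV dW hdW → ℂ} (hf : IsSiegelDeltaSection L e dV hdV dW hdW χ s f) (hfc : Continuous f)
    (γ₀ : ratH L e dV hdV dW hdW) (h : HA L e dV hdV dW hdW) (S : Matrix (Fin n) (Fin n) L)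
    (Γ' : Subgroup (unipDelta L e dV hdV dW hdW))
    (hΓ' : ∀ u : unipDelta L e dV hdV dW hdW, u ∈ Γ' ↔ (u : HA L e dV hdV dW hdW) ∈ ratH L e dV hdV dW hdW ∧
      IsSiegelDelta L e dV hdV dW hdW ((γ₀ : HA L e dV hdV dW hdW) * (u : HA L e dV hdV dW hdW) * ((γ₀ : HA L e dV hdV dW hdW))⁻¹))
    {β₁ : unipDelta L e dV hdV dW hdW → ℝ≥0∞} (hβ₁ : IsCoveringWeight Γ' β₁)
    (hO : ∫⁻ u, (∑' q : ↥(Set.range (fun ν : unipDeltaRat L e dV hdV dW hdW =>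
        (Quotient.mk (MulAction.orbitRel (siegelDeltaRat L e dV hdV dW hdW) (ratH L e dV hdV dW hdW))
          (γ₀ * ⟨((ν : unipDelta L e dV hdV dW hdW) : HA L e dV hdV dW hdW), coe_mem_ratH ν⟩)))),
        ‖f (((Quotient.out q.1 : ratH L e dV hdV dW hdW) : HA L e dV hdV dW hdW) * ((u : HA L e dV hdV dW hdW) * h))‖ₑ) * β u ∂νN ≠ ∞) :
    ∑' q : ↥(Set.range (fun ν : unipDeltaRat L e dV hdV dW hdW =>
        (Quotient.mk (MulAction.orbitRel (siegelDeltaRat L e dV hdV dW hdW) (ratH L e dV hdV dW hdW))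
          (γ₀ * ⟨((ν : unipDelta L e dV hdV dW hdW) : HA L e dV hdV dW hdW), coe_mem_ratH ν⟩)))),
      ∫ u, (β u).toReal • (conj (unipDeltaChar L e dV hdV dW hdW S (u : HA L e dV hdV dW hdW) : ℂ) *
        f (((Quotient.out q.1 : ratH L e dV hdV dW hdW) : HA L e dV hdV dW hdW) * ((u : HA L e dV hdV dW hdW) * h))) ∂νN =
      ∫ u, (β₁ u).toReal • (conj (unipDeltaChar L e dV hdV dW hdW S (u : HA L e dV hdV dW hdW) : ℂ) *
        f ((γ₀ : HA L e dV hdV dW hdW) * (u : HA L e dV hdV dW hdW) * h)) ∂νN := by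
  classical
  haveI : Countable (unipDeltaRat L e dV hdV dW hdW) := countable_unipDeltaRat L e dV hdV dW hdW
  haveI : Countable (ratH L e dV hdV dW hdW) := countable_ratH L e dV hdV dW hdW
  haveI : Countable (SiegelDeltaQuot L e dV hdV dW hdW) := by unfold SiegelDeltaQuot; exact inferInstance
  have hΓ'le : Γ' ≤ unipDeltaRat L e dV hdV dW hdW := fun u hu => (mem_unipDeltaRat_iff L e dV hdV dW hdW u).2 ((hΓ' u).1 hu).1
  have hΓ'P : ∀ γ ∈ Γ', IsSiegelDelta L e dV hdV dW hdW
      ((γ₀ : HA L e dV hdV dW hdW) * ((γ : unipDelta L e dV hdV dW hdW) : HA L e dV hdV dW hdW) * ((γ₀ : HA L e dV hdV dW hdW))⁻¹) :=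
    fun γ hγ => ((hΓ' γ).1 hγ).2
  haveI : Countable Γ' := (Subgroup.inclusion_injective hΓ'le).countable
  set mk : ratH L e dV hdV dW hdW → SiegelDeltaQuot L e dV hdV dW hdW :=
    Quotient.mk (MulAction.orbitRel (siegelDeltaRat L e dV hdV dW hdW) (ratH L e dV hdV dW hdW)) with hmk
  -- `ι ν := ν` seen in `H(L⁺)`; `ι (a b⁻¹) = ι a (ι b)⁻¹`
  have hιmul : ∀ a b : unipDeltaRat L e dV hdV dW hdW, (⟨(((a * b⁻¹) : unipDelta L e dV hdV dW hdW) : HA L e dV hdV dW hdW), coe_mem_ratH (a * b⁻¹)⟩ : ratH L e dV hdV dW hdW) = (⟨(((a) : unipDelta L e dV hdV dW hdW) : HA L e dV hdV dW hdW), coe_mem_ratH (a)⟩ : ratH L e dV hdV dW hdW) * ((⟨(((b) : unipDelta L e dV hdV dW hdW) : HA L e dV hdV dW hdW), coe_mem_ratH (b)⟩ : ratH L e dV hdV dW hdW))⁻¹ := fun a b => rfl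
  -- `[γ₀ a] = [γ₀ b] ⟺ a b⁻¹ ∈ Γ'`
  have hstab : ∀ a b : unipDeltaRat L e dV hdV dW hdW, mk (γ₀ * (⟨(((a) : unipDelta L e dV hdV dW hdW) : HA L e dV hdV dW hdW), coe_mem_ratH (a)⟩ : ratH L e dV hdV dW hdW)) = mk (γ₀ * (⟨(((b) : unipDelta L e dV hdV dW hdW) : HA L e dV hdV dW hdW), coe_mem_ratH (b)⟩ : ratH L e dV hdV dW hdW)) →
      (a : unipDelta L e dV hdV dW hdW) * (b : unipDelta L e dV hdV dW hdW)⁻¹ ∈ Γ' := by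
    intro a b hab
    have hab' : mk (γ₀ * (⟨(((a * b⁻¹) : unipDelta L e dV hdV dW hdW) : HA L e dV hdV dW hdW), coe_mem_ratH (a * b⁻¹)⟩ : ratH L e dV hdV dW hdW)) = mk γ₀ := by
      rw [hιmul]; exact (mk_mul_eq_mk_mul_iff γ₀ _ _).1 hab
    exact (hΓ' _).2 ⟨(mem_unipDeltaRat_iff L e dV hdV dW hdW _).1 (a * b⁻¹).2, (mk_mul_coe_eq_mk_iff γ₀ (a * b⁻¹)).1 hab'⟩
  have hstab' : ∀ a b : unipDeltaRat L e dV hdV dW hdW, (a : unipDelta L e dV hdV dW hdW) * (b : unipDelta L e dV hdV dW hdW)⁻¹ ∈ Γ' →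
      mk (γ₀ * (⟨(((a) : unipDelta L e dV hdV dW hdW) : HA L e dV hdV dW hdW), coe_mem_ratH (a)⟩ : ratH L e dV hdV dW hdW)) = mk (γ₀ * (⟨(((b) : unipDelta L e dV hdV dW hdW) : HA L e dV hdV dW hdW), coe_mem_ratH (b)⟩ : ratH L e dV hdV dW hdW)) := by
    intro a b hab
    have hab' : mk (γ₀ * (⟨(((a * b⁻¹) : unipDelta L e dV hdV dW hdW) : HA L e dV hdV dW hdW), coe_mem_ratH (a * b⁻¹)⟩ : ratH L e dV hdV dW hdW)) = mk γ₀ := (mk_mul_coe_eq_mk_iff γ₀ (a * b⁻¹)).2 ((hΓ' _).1 hab).2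
    rw [hιmul] at hab'
    exact (mk_mul_eq_mk_mul_iff γ₀ _ _).2 hab'
  -- the section `q ↦ ν q`, `[γ₀ ν_q] = q`
  have hsec : ∀ q : ↥(Set.range (fun ν : unipDeltaRat L e dV hdV dW hdW => mk (γ₀ * (⟨(((ν) : unipDelta L e dV hdV dW hdW) : HA L e dV hdV dW hdW), coe_mem_ratH (ν)⟩ : ratH L e dV hdV dW hdW)))),
      ∃ ν₁ : unipDeltaRat L e dV hdV dW hdW, mk (γ₀ * (⟨(((ν₁) : unipDelta L e dV hdV dW hdW) : HA L e dV hdV dW hdW), coe_mem_ratH (ν₁)⟩ : ratH L e dV hdV dW hdW)) = q.1 := fun q => q.2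
  choose ν hνq using hsec
  have hν : ∀ γ ∈ unipDeltaRat L e dV hdV dW hdW, ∃! i, γ * ((ν i : unipDelta L e dV hdV dW hdW))⁻¹ ∈ Γ' := by
    intro γ hγ
    refine ⟨⟨mk (γ₀ * (⟨((((⟨γ, hγ⟩ : unipDeltaRat L e dV hdV dW hdW)) : unipDelta L e dV hdV dW hdW) : HA L e dV hdV dW hdW), coe_mem_ratH ((⟨γ, hγ⟩ : unipDeltaRat L e dV hdV dW hdW))⟩ : ratH L e dV hdV dW hdW)), ⟨γ, hγ⟩, rfl⟩, hstab ⟨γ, hγ⟩ _ (by rw [hνq]), fun j hj => Subtype.ext ?_⟩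
    rw [← hνq j]
    exact (hstab' ⟨γ, hγ⟩ _ hj).symm
  -- integrand identification `f(γ_q x) = f(γ₀ ν_q x)`
  have hout : ∀ (q : ↥(Set.range (fun ν : unipDeltaRat L e dV hdV dW hdW => mk (γ₀ * (⟨(((ν) : unipDelta L e dV hdV dW hdW) : HA L e dV hdV dW hdW), coe_mem_ratH (ν)⟩ : ratH L e dV hdV dW hdW))))) (x : HA L e dV hdV dW hdW),
      f (((Quotient.out q.1 : ratH L e dV hdV dW hdW) : HA L e dV hdV dW hdW) * x) =
        f ((γ₀ : HA L e dV hdV dW hdW) * (((ν q : unipDelta L e dV hdV dW hdW)) : HA L e dV hdV dW hdW) * x) := by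
    intro q x
    rw [← apply_out_orbit hf γ₀ (ν q) x]
    congr 4
    exact (hνq q).symm
  have hO' : ∫⁻ u, (∑' i, ‖f ((γ₀ : HA L e dV hdV dW hdW) * (((ν i : unipDelta L e dV hdV dW hdW)) : HA L e dV hdV dW hdW) *
      ((u : HA L e dV hdV dW hdW) * h))‖ₑ) * β u ∂νN ≠ ∞ := by
    simp only [hout] at hO
    exact hO
  have key := tsum_section_eq_integral_wt_smul νN hβ hf hfc γ₀ h S Γ' hΓ'le hΓ'P hβ₁ ν hν hO'
  simp only [hout]
  exact key

/-- **The `S = 0` reading (the middle cell of the CONSTANT TERM, no character)**: with `Γ' = Stab(γ₀)` and `β₁` any `Γ'`-covering weight,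
`Σ'_{q ∈ O(γ₀)} ∫ β(u) • f(γ_q u h) dνN(u) = ∫ β₁(u) • f(γ₀ u h) dνN(u)` (★ `unipDeltaChar_zero`). [cite: MoeglinWaldspurger1995, II.1.7] -/
theorem tsum_orbit_eq_integral_wt_smul_zero (νN : Measure (unipDelta L e dV hdV dW hdW)) [νN.IsMulLeftInvariant]
    {β : unipDelta L e dV hdV dW hdW → ℝ≥0∞} (hβ : IsCoveringWeight (unipDeltaRat L e dV hdV dW hdW) β)
    {χ : HeckeCharacter L} {s : ℂ} {f : HA L e dV hdV dW hdW → ℂ} (hf : IsSiegelDeltaSection L e dV hdV dW hdW χ s f) (hfc : Continuous f)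
    (γ₀ : ratH L e dV hdV dW hdW) (h : HA L e dV hdV dW hdW)
    (Γ' : Subgroup (unipDelta L e dV hdV dW hdW))
    (hΓ' : ∀ u : unipDelta L e dV hdV dW hdW, u ∈ Γ' ↔ (u : HA L e dV hdV dW hdW) ∈ ratH L e dV hdV dW hdW ∧
      IsSiegelDelta L e dV hdV dW hdW ((γ₀ : HA L e dV hdV dW hdW) * (u : HA L e dV hdV dW hdW) * ((γ₀ : HA L e dV hdV dW hdW))⁻¹))
    {β₁ : unipDelta L e dV hdV dW hdW → ℝ≥0∞} (hβ₁ : IsCoveringWeight Γ' β₁)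
    (hO : ∫⁻ u, (∑' q : ↥(Set.range (fun ν : unipDeltaRat L e dV hdV dW hdW =>
        (Quotient.mk (MulAction.orbitRel (siegelDeltaRat L e dV hdV dW hdW) (ratH L e dV hdV dW hdW))
          (γ₀ * ⟨((ν : unipDelta L e dV hdV dW hdW) : HA L e dV hdV dW hdW), coe_mem_ratH ν⟩)))),
        ‖f (((Quotient.out q.1 : ratH L e dV hdV dW hdW) : HA L e dV hdV dW hdW) * ((u : HA L e dV hdV dW hdW) * h))‖ₑ) * β u ∂νN ≠ ∞) :
    ∑' q : ↥(Set.range (fun ν : unipDeltaRat L e dV hdV dW hdW =>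
        (Quotient.mk (MulAction.orbitRel (siegelDeltaRat L e dV hdV dW hdW) (ratH L e dV hdV dW hdW))
          (γ₀ * ⟨((ν : unipDelta L e dV hdV dW hdW) : HA L e dV hdV dW hdW), coe_mem_ratH ν⟩)))),
      ∫ u, (β u).toReal • f (((Quotient.out q.1 : ratH L e dV hdV dW hdW) : HA L e dV hdV dW hdW) * ((u : HA L e dV hdV dW hdW) * h)) ∂νN =
      ∫ u, (β₁ u).toReal • f ((γ₀ : HA L e dV hdV dW hdW) * (u : HA L e dV hdV dW hdW) * h) ∂νN := by
  have key := tsum_orbit_eq_integral_wt_smul νN hβ hf hfc γ₀ h 0 Γ' hΓ' hβ₁ hO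
  simp only [unipDeltaChar_zero, Circle.coe_one, map_one, one_mul] at key
  exact key

end Summit.HodgeConjecture.HodgeConjecture.Cruxes.HLiu418.K2LiuSiegelMiddleOrbitUnfold

end
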